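import Literature.NumberTheory.GaloisRepresentations.LubinTateComparisonReflectionTwo
import Literature.NumberTheory.GaloisRepresentations.LubinTateColemanTraceTwo
import HarnessLib

/-!
# `q = 2`: from Coleman's `𝒮_{f'} h = 0` over `𝒪[F]` to the vanishing of the `Ĝ_m`-trace of `h ∘ ϑ` at all
# `2`-power roots of unity in `ℂ_F` — the θ-transport of de Shalit's (7) ⟹ (7′), end to end

Topic `NumberTheory/GaloisRepresentations`; namespace `Literature.NumberTheory.GaloisRepresentations`.

De Shalit, *Iwasawa theory of elliptic curves with complex multiplication* (1987), I.3.3: the measure of a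
norm-coherent unit is supported on `ℤ_p^×` because its power series kills the `Ĝ_m`-trace ((7) ⟺ (7′)),
the series being read on `Ĝ_m` through `θ : Ĝ_m ≃ F_{f'}` (I.3.2 (3)).  This file composes the tree's
`q = 2` Coleman theory over `𝒪[F]` (`colemanTrace`, `reflTwo`, `subst_colemanTrace_two`:
`(𝒮h) ∘ f' = h + h(−π' − X)`, file `LubinTateColemanTraceTwo.lean`) with the θ-transport on `𝔪_ℂ`
(`LubinTateComparisonReflectionTwo.lean`):

* `LubinTate.map_evT` — a continuous ring map `ψ : S → S'` carries the topological evaluation `G(t)` of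
  `S⟦X⟧` at a point `t` to that of `S'⟦X⟧` (`ψ(G(t)) = (ψG)(ψt)`);
* ★ `evS_map_reflect_of_reflTwo_eq_neg` — if `h₀(−π' − X) = −h₀` in `𝒪[F]⟦X⟧` (`reflTwo … h₀ = −h₀`) then
  the image `h` of `h₀` in `𝒪_{ℂ_F}⟦X⟧` satisfies **`h(−π' − y) = −h(y)` for all `y ∈ 𝔪_ℂ`** (the hypothesis
  of the seam `evS_subst_compSeriesC_reflect`), via `K_{π'}^{n+1} ⊆ ℂ_F` (`unitBallToCBall`);
* ★ `reflTwo_eq_neg_of_colemanTrace_eq_zero` — `𝒮h₀ = 0 ⟹ h₀(−π' − X) = −h₀`;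
* ★★★ `sum_nthRootsFinset_tsum_eq_zero_of_colemanTrace_eq_zero` — **for `h₀ ∈ 𝒪[F]⟦X⟧` with
  `𝒮_{f'} h₀ = 0` (`f' = π'X + X²`, `π' = 2u`) and `H := h₀ ∘ ϑ ∈ 𝒪_{ℂ_F}⟦S⟧`:
  `Σ_{w² = 1} Σ_m H_m (ζw − 1)^m = 0` for every `ζ ∈ ℂ_F` with `ζ^{2^n} = 1`** — the composite of
  cf2c-w7's units lane output (`PadicTwo.colemanTrace_eq_zero_iff_cyclotomic`, `tildeSer_logDeriv…`) with the
  measure side's support criterion (`forall_invAmice₁_μ_eq_zero_of_nthRoots`, there over `ℂ_[p]`).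

Everything is proved; no named facts, no definitions, no instances, no `sorry`.

## References

* [deShalit1987] E. de Shalit, *Iwasawa theory of elliptic curves with complex multiplication* (1987),
  I.3.2 (3)–(5), I.3.3 (7)–(7′) (p. 17), I.3.12 (23).
* [CasselsFrohlichANT1967] J.-P. Serre, *Local class field theory*, Ch. VI of Cassels–Fröhlich (1967), §3.2.
-/

noncomputable section

open MvPowerSeries
open scoped PowerSeries.WithPiTopology

namespace Literature.NumberTheory.GaloisRepresentations

namespace LubinTate

/-! ### Transport of `evT` along a continuous ring map -/

section MapEvT

variable {S : Type*} [CommRing S] [UniformSpace S] [IsUniformAddGroup S] [IsTopologicalRing S]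
  [IsLinearTopology S S] [T2Space S] [CompleteSpace S]
variable {S' : Type*} [CommRing S'] [UniformSpace S'] [IsUniformAddGroup S'] [IsTopologicalRing S']
  [IsLinearTopology S' S'] [T2Space S'] [CompleteSpace S']
variable (M : NilIdeal S) (M' : NilIdeal S')

omit [IsUniformAddGroup S] [IsTopologicalRing S] [IsLinearTopology S S] [T2Space S] [CompleteSpace S]
  [IsUniformAddGroup S'] [IsTopologicalRing S'] [IsLinearTopology S' S'] [T2Space S'] [CompleteSpace S'] in
/-- `PowerSeries.map ψ` is continuous for the product topologies when `ψ` is continuous.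
[cite: CasselsFrohlichANT1967, Ch. VI §3.2] -/
theorem continuous_powerSeries_map (ψ : S →+* S') (hψ : Continuous ψ) :
    Continuous (PowerSeries.map ψ : PowerSeries S → PowerSeries S') := by
  refine continuous_pi fun d => ?_
  have : (fun G : PowerSeries S => (PowerSeries.map ψ G) d) = fun G => ψ (G d) := by
    funext G
    exact MvPowerSeries.coeff_map _ _ _
  rw [this]
  exact hψ.comp (continuous_apply d)

/-- ★ **`ψ(G(t)) = (ψG)(ψt)`**: a continuous ring map carries topological evaluation at points of `S⟦X⟧`
to that of `S'⟦X⟧`. [cite: CasselsFrohlichANT1967, Ch. VI §3.2] -/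
theorem map_evT (ψ : S →+* S') (hψ : Continuous ψ) (t : (seriesNilIdeal M).toIdeal)
    (ht : PowerSeries.map ψ (t : PowerSeries S) ∈ (seriesNilIdeal M').toIdeal) (G : PowerSeries S) :
    PowerSeries.map ψ (evT M t G) = evT M' ⟨PowerSeries.map ψ (t : PowerSeries S), ht⟩ (PowerSeries.map ψ G) := by
  have h1 := (PowerSeries.hasSum_aeval ((seriesNilIdeal M).isTopologicallyNilpotent _ t.2) G).map
    (PowerSeries.map ψ) (continuous_powerSeries_map ψ hψ)
  have h2 := PowerSeries.hasSum_aeval ((seriesNilIdeal M').isTopologicallyNilpotent _ ht) (PowerSeries.map ψ G)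
  have hfun : (⇑(PowerSeries.map ψ) ∘ fun d : ℕ => PowerSeries.coeff d G • (t : PowerSeries S) ^ d) =
      fun d : ℕ => PowerSeries.coeff d (PowerSeries.map ψ G) •
        (PowerSeries.map ψ (t : PowerSeries S)) ^ d := by
    funext d
    simp only [Function.comp_apply, PowerSeries.coeff_map, PowerSeries.smul_eq_C_mul, map_mul, map_pow,
      PowerSeries.map_C]
  rw [hfun] at h1
  exact h1.unique h2

end MapEvT

end LubinTate

/-! ### From `𝒮_{f'} h₀ = 0` over `𝒪[F]` to the `Ĝ_m`-trace of `h₀ ∘ ϑ` on `ℂ_F` -/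

section TraceTransportTwo

open ValuativeRel IsLocalRing Field IsNonarchimedeanLocalField LubinTate
open Literature.NumberTheory.PAdicHodge

variable {F : Type} [Field F] [ValuativeRel F] [TopologicalSpace F] [IsNonarchimedeanLocalField F]

attribute [local instance] ltNormUniformSpace ltNormIsUniformAddGroup rk1 nF nE fintypeResidueField

variable (hq : residueFieldCard F = 2) (h2 : (valuation F).IsUniformizer (((2 : ℕ) : 𝒪[F]) : F))
  {σ₀ : absoluteGaloisGroup F} (hσ₀ : IsAbsArithFrob σ₀) (u : 𝒪[F]ˣ)
  {ε : (maxUnramifiedCompletion F)ˣ}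
  (hε : maxUnramifiedCompletion.galAut F σ₀ (ε : maxUnramifiedCompletion F) =
    algebraMap 𝒪[F] (maxUnramifiedCompletion F) (u : 𝒪[F]) * (ε : maxUnramifiedCompletion F))

/-- The coefficient map `𝒪_E → 𝒪_{ℂ_F}` composed with `𝒪[F] → 𝒪_E` is the coefficient map
`𝒪[F] → 𝒪̂_{F^nr} → 𝒪_{ℂ_F}` (tree `unitBallToCBall_algebraMap`). [cite: CasselsFrohlichANT1967, Ch. VI §3.2] -/
theorem unitBallToCBall_comp_algebraMap (E : IntermediateField F (AlgebraicClosure F)) [FiniteDimensional F E] :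
    (unitBallToCBall E).comp (algebraMap (LTCoeff F) (unitBall E)) =
      (algebraMap (UnrCoeff F) (CBall F)).comp ((intToUnrCoeff F).comp (LTCoeff.of F).symm.toRingHom) :=
  RingHom.ext fun c => unitBallToCBall_algebraMap E c

/-- The element `π'` read in `ℂ_F` through the coefficient maps is `π' ∈ F ⊆ ℂ_F`.
[cite: CasselsFrohlichANT1967, Ch. VI §3.2] -/
theorem coe_algebraMap_intToUnrCoeff (a : 𝒪[F]) :
    ((algebraMap (UnrCoeff F) (CBall F) (intToUnrCoeff F a) : CBall F) : CompletedAlgClosure F) =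
      algebraMap F (CompletedAlgClosure F) (a : F) := by
  rw [algebraMap_unrCoeff_coe, intToUnrCoeff, RingHom.comp_apply]
  exact toC_algebraMap a

include hq in
/-- ★ **`h₀(−π' − X) = −h₀` in `𝒪[F]⟦X⟧` ⟹ `h(−π' − y) = −h(y)` on `𝔪_ℂ`** for the image `h` of `h₀` in
`𝒪_{ℂ_F}⟦X⟧`: the reflection identity descends from `K_{π'}^{n+1}⟦X⟧` (`map_reflTwo_eq_evT`,
`coe_tPt_ltDivPt_two`) to `𝒪_{ℂ_F}⟦X⟧` along `unitBallToCBall` (`map_evT`) and is then evaluated at points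
(`evS_evT`). [cite: deShalit1987, I.3.3 (7) (p. 17)] -/
theorem evS_map_reflect_of_reflTwo_eq_neg {π' : 𝒪[F]} (hπ' : (valuation F).IsUniformizer (π' : F)) (n : ℕ)
    (h₀ : PowerSeries (LTCoeff F)) (hr : reflTwo hπ' n h₀ = -h₀)
    (y y' : (maxNilIdealC F).toIdeal)
    (hy' : ((y' : CBall F) : CompletedAlgClosure F) =
      -algebraMap F (CompletedAlgClosure F) (π' : F) - ((y : CBall F) : CompletedAlgClosure F)) :
    evS (maxNilIdealC F) y'
        (h₀.map ((algebraMap (UnrCoeff F) (CBall F)).comp ((intToUnrCoeff F).comp (LTCoeff.of F).symm.toRingHom))) =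
      -evS (maxNilIdealC F) y
        (h₀.map ((algebraMap (UnrCoeff F) (CBall F)).comp ((intToUnrCoeff F).comp (LTCoeff.of F).symm.toRingHom))) := by
  set E := ltField π' n with hE
  set ψ : unitBall (ltField π' n) →+* CBall F := unitBallToCBall (ltField π' n) with hψ
  set ιC : LTCoeff F →+* CBall F :=
    (algebraMap (UnrCoeff F) (CBall F)).comp ((intToUnrCoeff F).comp (LTCoeff.of F).symm.toRingHom) with hιC
  have hψι : ψ.comp (algebraMap (LTCoeff F) (unitBall (ltField π' n))) = ιC :=
    unitBallToCBall_comp_algebraMap (ltField π' n)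
  set h : PowerSeries (CBall F) := h₀.map ιC with hh
  -- the reflection identity over `𝒪_{K^{n+1}}`
  set t₁ := tPt (maxNilIdeal F (ltField π' n)) (isLTRing_LTCoeff hπ') (isLTSeries_LTCoeff π') (ltDivPt hπ' n 1)
    with ht₁
  have h1 := map_reflTwo_eq_evT hπ' n hq h₀
  rw [hr, map_neg] at h1
  -- push to `𝒪_{ℂ_F}⟦X⟧`
  have hp : algebraMap 𝒪[F] (unitBall (ltField π' n)) π' = algebraMap (LTCoeff F) (unitBall (ltField π' n))
      (LTCoeff.of F π') := rfl
  have hπC : ψ (algebraMap (LTCoeff F) (unitBall (ltField π' n)) (LTCoeff.of F π')) = ιC (LTCoeff.of F π') := by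
    rw [← hψι, RingHom.comp_apply]
  have hmapmap : ∀ G : PowerSeries (LTCoeff F),
      PowerSeries.map ψ (PowerSeries.map (algebraMap (LTCoeff F) (unitBall (ltField π' n))) G) =
        PowerSeries.map ιC G := fun G => by
    rw [← hψι, PowerSeries.map_comp, RingHom.comp_apply]
  have ht₁C : PowerSeries.map ψ (t₁ : PowerSeries (unitBall (ltField π' n))) =
      -PowerSeries.X - PowerSeries.C (ιC (LTCoeff.of F π')) := by
    rw [ht₁, coe_tPt_ltDivPt_two hπ' n hq one_ne_zero, map_sub, map_neg, PowerSeries.map_X, PowerSeries.map_C, hp,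
      hπC]
  have hιCπ : ((ιC (LTCoeff.of F π') : CBall F) : CompletedAlgClosure F) =
      algebraMap F (CompletedAlgClosure F) (π' : F) := by
    rw [hιC, RingHom.comp_apply, RingHom.comp_apply, RingEquiv.toRingHom_eq_coe, RingHom.coe_coe,
      RingEquiv.symm_apply_apply, coe_algebraMap_intToUnrCoeff]
  have htmem : PowerSeries.map ψ (t₁ : PowerSeries (unitBall (ltField π' n))) ∈
      (seriesNilIdeal (maxNilIdealC F)).toIdeal := by
    rw [mem_seriesNilIdeal_iff, ht₁C, map_sub, map_neg, PowerSeries.constantCoeff_X, neg_zero, zero_sub,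
      PowerSeries.constantCoeff_C]
    refine neg_mem ?_
    change ‖((ιC (LTCoeff.of F π') : CBall F) : CompletedAlgClosure F)‖ < 1
    rw [hιCπ, CompletedAlgClosure.norm_algebraMap]
    exact (norm_lt_one_iff F _).mpr hπ'.val_lt_one
  have h2 := congrArg (PowerSeries.map ψ) h1
  rw [map_neg, hmapmap, map_evT (maxNilIdeal F (ltField π' n)) (maxNilIdealC F) ψ
    (continuous_unitBallToCBall (ltField π' n)) t₁ htmem, hmapmap] at h2
  -- `h2 : -h = evT M_C t_C h`; evaluate at `y`
  have h3 := congrArg (evS (maxNilIdealC F) y) h2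
  rw [map_neg, evS_evT] at h3
  -- the point `t_C(y) = −π' − y` is `y'`
  have hpt : evSPt (maxNilIdealC F) y ⟨PowerSeries.map ψ (t₁ : PowerSeries (unitBall (ltField π' n))), htmem⟩ = y' := by
    apply Subtype.ext; apply Subtype.ext
    change (((evS (maxNilIdealC F) y (PowerSeries.map ψ (t₁ : PowerSeries (unitBall (ltField π' n))))) : CBall F) :
      CompletedAlgClosure F) = _
    rw [ht₁C, map_sub, map_neg, evS_X, evS_C, hy']
    push_cast
    rw [hιCπ]
    ring
  rw [hpt] at h3
  exact h3.symm

include hq in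
/-- ★ **`𝒮_{f'} h₀ = 0 ⟹ h₀(−π' − X) = −h₀`** (`(𝒮h₀) ∘ f' = h₀ + h₀(−π' − X)` at `q = 2`).
[cite: deShalit1987, I.3.12 (23), I.3.3 (7)] -/
theorem reflTwo_eq_neg_of_colemanTrace_eq_zero {π' : 𝒪[F]} (hπ' : (valuation F).IsUniformizer (π' : F))
    (n : ℕ) (h₀ : PowerSeries (LTCoeff F)) (hS : colemanTrace hπ' n h₀ = 0) : reflTwo hπ' n h₀ = -h₀ := by
  have h := subst_colemanTrace_two hπ' n hq h₀
  rw [hS, ← PowerSeries.coe_substAlgHom (PowerSeries.HasSubst.of_constantCoeff_zero'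
    (isLTSeries_ltSer π').constantCoeff_eq_zero), map_zero] at h
  linear_combination -h

include hq in
/-- ★★★ **End to end at `q = 2`**: for `h₀ ∈ 𝒪[F]⟦X⟧` with `𝒮_{f'} h₀ = 0` (`f' = π'X + X²`, `π' = u·2`,
Coleman's trace operator over `𝒪[F]`) and `H := h₀ ∘ ϑ ∈ 𝒪_{ℂ_F}⟦S⟧` (`ϑ = compSeriesC : Ĝ_m → F_{f'}`),
**`Σ_{w² = 1} Σ_m H_m (ζw − 1)^m = 0` for every `2`-power root of unity `ζ ∈ ℂ_F`**: de Shalit's (7) ⟹ (7′),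
i.e. the series of the measure of a trace-zero unit kills the `Ĝ_m`-trace, so the measure lives on `ℤ₂^×`.
[cite: deShalit1987, I.3.3 (7)–(7′) (p. 17)] -/
theorem sum_nthRootsFinset_tsum_eq_zero_of_colemanTrace_eq_zero (n : ℕ) (h₀ : PowerSeries (LTCoeff F))
    (hS : colemanTrace (isUniformizer_unit_mul h2 u) n h₀ = 0)
    {ζ : CompletedAlgClosure F} {m : ℕ} (hζ : ζ ^ 2 ^ m = 1) :
    ∑ w ∈ Polynomial.nthRootsFinset 2 (1 : CompletedAlgClosure F),
      ∑' k : ℕ, ((PowerSeries.coeff k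
          (PowerSeries.subst ((compSeriesC h2 hσ₀ u hε).map (algebraMap (UnrCoeff F) (CBall F)))
            (h₀.map ((algebraMap (UnrCoeff F) (CBall F)).comp
              ((intToUnrCoeff F).comp (LTCoeff.of F).symm.toRingHom)))) : CBall F) :
            CompletedAlgClosure F) * (ζ * w - 1) ^ k = 0 :=
  sum_nthRootsFinset_tsum_coeff_subst_compSeriesC_eq_zero hq h2 hσ₀ u hε _
    (fun y y' hy' ↦ evS_map_reflect_of_reflTwo_eq_neg hq (isUniformizer_unit_mul h2 u) n h₀
      (reflTwo_eq_neg_of_colemanTrace_eq_zero hq _ n h₀ hS) y y' hy') hζ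

end TraceTransportTwo

end Literature.NumberTheory.GaloisRepresentations

end
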